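/-
Copyright (c) 2026. Released under the Apache 2.0 license.
-/
import Literature.NumberTheory.EllipticCurves.ManinConstantClassCertificateTwistAtTwo
import Literature.NumberTheory.EllipticCurves.ManinConstantQuadraticTwistAtTwoOrdinaryProofs
import HarnessLib

/-!
# The twist-covered class certificate at `2` in EVERY case `η = 1`: displayed witness
# `TwistEtaOneWitnessAtTwo`, class predicate `IsEdixhovenCesnaviciusTwistCoveredTwoEtaOne`

Topic `Literature/NumberTheory/EllipticCurves`; namespace `Literature.NumberTheory.EllipticCurves.ModularForms`.
Two predicates (definitions; nothing asserted) and their proved consumers; NO named fact.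

`ManinConstantClassCertificateTwistAtTwo.lean` names the per-member witness at `2`
(`TwistSemistableWitnessAtTwo W'`: `W' ∼ V ⊗ ℚ(√d)`, `d ∈ {−1, 2, −2}`, `V` semistable at `2`,
with the clause `d = −1 ∨ 2 ∣ N(V)`) and the class predicate `IsEdixhovenCesnaviciusTwistCoveredTwo`.
`ManinConstantQuadraticTwistAtTwoOrdinaryProofs.lean` proves the per-pair theorem and the class
certificate with that clause widened to `d = −1 ∨ 2 ∣ N(V) ∨ a₂(V)` odd — every case `η = 1` of
Stevens 1989 Lemma (5.2) ("`η = 2` if the conductor of `ψ` is divisible by `8`, and `A` has good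
supersingular reduction at `2`; `1` otherwise"; `A = V` good at `2` is ordinary iff `a₂(V)` is
odd), with the hypothesis spelled out. This file names it:

* `TwistEtaOneWitnessAtTwo W'` — the displayed per-member hypothesis at `2` with the widened
  clause; `TwistSemistableWitnessAtTwo W'` implies it (`TwistSemistableWitnessAtTwo.etaOne`).
* `not_dvd_maninConstant_of_twistEtaOneWitnessAtTwo_gamma0` — `2 ∤ c`, binders `hM hAU hC2 hnf`.
* `IsEdixhovenCesnaviciusTwistCoveredTwoEtaOne W` — at every square prime `p` of every globally
  minimal member `W'`: (`p > 7` and `EdixhovenNonexceptionalAt W' p`) or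
  `TwistSemistableWitnessAt W' p` or (`p = 2` and `TwistEtaOneWitnessAtTwo W'`);
  `IsEdixhovenCesnaviciusTwistCoveredTwo W` implies it.
* `classAbsManinConstantEqOne_of_isEdixhovenCesnaviciusTwistCoveredTwoEtaOne_gamma0` and the
  binder form — the class certificate, binders `hM hAU hC hEA hEB hnf`
  (`:= classAbsManinConstantEqOne_of_forall_sq_prime_edixhoven_or_twist_or_twistAtTwo_gamma0`).

## References
* [Stevens1989] G. Stevens, Invent. Math. 98 (1989), §5 Lemma (5.2) p. 96 (definition of `η`),
  Lemma (5.4) p. 97.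
* [SilvermanAEC2009] J. H. Silverman, *The Arithmetic of Elliptic Curves*, 2nd ed., V.4 (first
  paragraph) and Exercises 5.7, 5.10(a) (ordinary at `2` iff `ā₁ ≠ 0` iff `a₂` odd).
* [Cesnavicius2018] K. Česnavičius, Compositio Math. 154 (2018), Thm. 1.2.
* [EdixhovenManin1991] B. Edixhoven, Progr. Math. 89 (1991), §1 and Thm. 3.
* [Mazur1978] Cor. 4.1; [AbbesUllmo1996] Thm. A.
-/

noncomputable section

open scoped Classical

open WeierstrassCurve

namespace Literature.NumberTheory.EllipticCurves.ModularForms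

/-! ### The per-member hypothesis of the twist road at `2`, every case `η = 1` -/

/-- **"At `2`, the class of `W'` is the `χ₋₄`/`χ₈`/`χ₋₈`-twist of a class semistable at `2`, in
a case `η = 1` of Stevens' Lemma (5.2), with witness and bookkeeping displayed"**: a parameter
`d ∈ {−1, 2, −2}`; a globally minimal elliptic `V` with `W' ∼ V.quadraticTwist d`; `N(V) ∣ N(W')`;
`(4|d|)² ∣ N(W')`; `4 ∤ N(V)`; `d = −1 ∨ 2 ∣ N(V) ∨ a₂(V)` odd (`a₂(V) = V.LFunction 2`; i.e.
NOT (`8 ∣ cond χ` and `V` good supersingular at `2`)); and `W'` additive at `2`. A predicate;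
nothing asserted. [cite: Stevens1989, §5 Lemma (5.2) p. 96 (the twisting hypothesis, with η)]
[cite: SilvermanAEC2009, V.4 and Exercise 5.10(a)] -/
def TwistEtaOneWitnessAtTwo (W' : WeierstrassCurve ℚ) : Prop :=
  ∃ (d : ℤ) (V : WeierstrassCurve ℚ) (_ : V.IsElliptic) (_ : V.IsGloballyMinimal),
    (d = -1 ∨ d = 2 ∨ d = -2) ∧
    IsIsogenous W' (V.quadraticTwist (d : ℚ)) ∧
    V.conductorNorm ℤ ∣ W'.conductorNorm ℤ ∧ (4 * d.natAbs) ^ 2 ∣ W'.conductorNorm ℤ ∧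
    ¬ 2 ^ 2 ∣ V.conductorNorm ℤ ∧ (d = -1 ∨ 2 ∣ V.conductorNorm ℤ ∨ Odd (V.LFunction 2)) ∧
    (¬ W'.HasGoodReductionAtPrime 2 ∧ ¬ W'.HasMultiplicativeReductionAtPrime 2)

/-- Unfolding of `TwistEtaOneWitnessAtTwo` (by `Iff.rfl`). [cite: Stevens1989, §5 Lemma (5.2)] -/
theorem twistEtaOneWitnessAtTwo_iff (W' : WeierstrassCurve ℚ) :
    TwistEtaOneWitnessAtTwo W' ↔
      ∃ (d : ℤ) (V : WeierstrassCurve ℚ) (_ : V.IsElliptic) (_ : V.IsGloballyMinimal),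
        (d = -1 ∨ d = 2 ∨ d = -2) ∧
        IsIsogenous W' (V.quadraticTwist (d : ℚ)) ∧
        V.conductorNorm ℤ ∣ W'.conductorNorm ℤ ∧ (4 * d.natAbs) ^ 2 ∣ W'.conductorNorm ℤ ∧
        ¬ 2 ^ 2 ∣ V.conductorNorm ℤ ∧ (d = -1 ∨ 2 ∣ V.conductorNorm ℤ ∨ Odd (V.LFunction 2)) ∧
        (¬ W'.HasGoodReductionAtPrime 2 ∧ ¬ W'.HasMultiplicativeReductionAtPrime 2) :=
  Iff.rfl

/-- The conductor-decided witness at `2` (`d = −1 ∨ 2 ∣ N(V)`) is a witness in a case `η = 1`.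
[cite: Stevens1989, §5 Lemma (5.2)] -/
theorem TwistSemistableWitnessAtTwo.etaOne {W' : WeierstrassCurve ℚ}
    (h : TwistSemistableWitnessAtTwo W') : TwistEtaOneWitnessAtTwo W' := by
  obtain ⟨d, V, hVE, hVM, hd, hiso, hdvd, hm, h4, hη, hadd⟩ := h
  exact ⟨d, V, hVE, hVM, hd, hiso, hdvd, hm, h4, by rcases hη with h | h <;> simp [h], hadd⟩

/-- **Per member, from the displayed witness at `2` (any case `η = 1`)**:
`TwistEtaOneWitnessAtTwo W'` gives `2 ∤ D'.maninConstant` for every lattice-optimal `X₀`-datum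
`D'` of the globally minimal `W'` — `Γ₀` road, binders `hM hAU hC2 hnf`
(`not_dvd_maninConstant_of_exists_twistAtTwo_etaOne_gamma0`).
[cite: Stevens1989, Lemmas (5.2), (5.4)] [cite: Cesnavicius2018, Thm. 1.2] -/
theorem not_dvd_maninConstant_of_twistEtaOneWitnessAtTwo_gamma0
    (hM : mazur_not_dvd_maninConstant_of_odd)
    (hAU : abbesUllmo_not_dvd_maninConstant_of_not_dvd_level)
    (hC2 : cesnavicius_not_two_dvd_maninConstant_of_two_dvd_level) (hnf : exists_isNewformOf)
    (W' : WeierstrassCurve ℚ) [W'.IsElliptic] [W'.IsGloballyMinimal] {N' : ℕ} [NeZero N']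
    (D' : ModularParametrizationData W' N')
    (hopt : ∀ z ∈ D'.L.lattice, ∃ w ∈ periodLattice D'.f, z = D'.c * w)
    (htw : TwistEtaOneWitnessAtTwo W') : ¬ (2 : ℤ) ∣ D'.maninConstant :=
  not_dvd_maninConstant_of_exists_twistAtTwo_etaOne_gamma0 hM hAU hC2 hnf W' D' hopt htw

/-! ### The class predicate and the certificate -/

/-- **The "Edixhoven–Česnavičius–twist covered" classes, the prime `2` included in every case
`η = 1`**: at every square prime `p` of the conductor of every globally minimal member `W'` of the
class of `W`, either `p > 7` and `EdixhovenNonexceptionalAt W' p`, or `TwistSemistableWitnessAt W' p`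
(odd twist road), or `p = 2` and `TwistEtaOneWitnessAtTwo W'`. A predicate; nothing asserted.
[cite: EdixhovenManin1991, §1 and Thm. 3] [cite: Cesnavicius2018, Thm. 1.2]
[cite: Stevens1989, §5 Lemma (5.2)] -/
def IsEdixhovenCesnaviciusTwistCoveredTwoEtaOne (W : WeierstrassCurve ℚ) : Prop :=
  ∀ (W' : WeierstrassCurve ℚ) [W'.IsElliptic] [W'.IsGloballyMinimal], IsIsogenous W W' →
    ∀ (p : ℕ) (hp : p.Prime), p ^ 2 ∣ W'.conductorNorm ℤ →
      (7 < p ∧ EdixhovenNonexceptionalAt W' p hp) ∨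
        @TwistSemistableWitnessAt W' p ⟨hp⟩ ∨ (p = 2 ∧ TwistEtaOneWitnessAtTwo W')

/-- Unfolding of `IsEdixhovenCesnaviciusTwistCoveredTwoEtaOne` (by `Iff.rfl`).
[cite: EdixhovenManin1991, §1 and Thm. 3] -/
theorem isEdixhovenCesnaviciusTwistCoveredTwoEtaOne_iff (W : WeierstrassCurve ℚ) :
    IsEdixhovenCesnaviciusTwistCoveredTwoEtaOne W ↔
      ∀ (W' : WeierstrassCurve ℚ) [W'.IsElliptic] [W'.IsGloballyMinimal], IsIsogenous W W' →
        ∀ (p : ℕ) (hp : p.Prime), p ^ 2 ∣ W'.conductorNorm ℤ →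
          (7 < p ∧ EdixhovenNonexceptionalAt W' p hp) ∨
            @TwistSemistableWitnessAt W' p ⟨hp⟩ ∨ (p = 2 ∧ TwistEtaOneWitnessAtTwo W') :=
  Iff.rfl

/-- A class covered with the conductor-decided witness at `2` is covered in a case `η = 1`.
[cite: EdixhovenManin1991, Thm. 3] [cite: Stevens1989, §5 Lemma (5.2)] -/
theorem IsEdixhovenCesnaviciusTwistCoveredTwo.etaOne {W : WeierstrassCurve ℚ}
    (h : IsEdixhovenCesnaviciusTwistCoveredTwo W) : IsEdixhovenCesnaviciusTwistCoveredTwoEtaOne W :=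
  fun W' _ _ hiso p hp hsq ↦ by
    rcases h W' hiso p hp hsq with h1 | h2 | ⟨h3, h4⟩
    · exact Or.inl h1
    · exact Or.inr (Or.inl h2)
    · exact Or.inr (Or.inr ⟨h3, h4.etaOne⟩)

/-- A twist-covered class (odd primes only) is covered with the prime `2` in a case `η = 1`.
[cite: EdixhovenManin1991, Thm. 3] -/
theorem IsEdixhovenCesnaviciusTwistCovered.coveredTwoEtaOne {W : WeierstrassCurve ℚ}
    (h : IsEdixhovenCesnaviciusTwistCovered W) : IsEdixhovenCesnaviciusTwistCoveredTwoEtaOne W :=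
  h.coveredTwo.etaOne

/-- **Edixhoven 1991 Thm. 3, OR the odd twist road, OR the twist road at `2` in any case `η = 1`,
at each square prime; Česnavičius 2018 Thm. 1.2 at the others — per class, `Γ₀` road, binders
`hM hAU hC hEA hEB hnf`.** If the class of `W` is covered
(`IsEdixhovenCesnaviciusTwistCoveredTwoEtaOne W`), the Manin constant of its optimal curve is `±1`
(`ClassAbsManinConstantEqOne W`) — this is
`classAbsManinConstantEqOne_of_forall_sq_prime_edixhoven_or_twist_or_twistAtTwo_gamma0` under its
name. [cite: EdixhovenManin1991, §1 and Thm. 3] [cite: Cesnavicius2018, Thm. 1.2]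
[cite: Stevens1989, Lemmas (5.2), (5.4)] [cite: Mazur1978, Cor. 4.1] [cite: AbbesUllmo1996, Thm. A] -/
theorem classAbsManinConstantEqOne_of_isEdixhovenCesnaviciusTwistCoveredTwoEtaOne_gamma0
    (hM : mazur_not_dvd_maninConstant_of_odd)
    (hAU : abbesUllmo_not_dvd_maninConstant_of_not_dvd_level)
    (hC : cesnavicius_not_two_dvd_maninConstant_of_two_dvd_level)
    (hEA : edixhoven_not_dvd_maninConstant_of_not_potentiallyGoodOrdinary)
    (hEB : edixhoven_not_dvd_maninConstant_of_kodairaSymbol_ne)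
    (hnf : exists_isNewformOf)
    (W : WeierstrassCurve ℚ) (hcov : IsEdixhovenCesnaviciusTwistCoveredTwoEtaOne W) :
    ClassAbsManinConstantEqOne W :=
  classAbsManinConstantEqOne_of_forall_sq_prime_edixhoven_or_twist_or_twistAtTwo_gamma0 hM hAU hC
    hEA hEB hnf W hcov

/-- The binder form carried by consumers (`Γ₀` road, prime `2` included in every case `η = 1`):
for a covered class, `p ∤ c` for EVERY prime `p` and every optimal datum of every globally minimal
member, modulo `hM hAU hC hEA hEB hnf`. [cite: EdixhovenManin1991, §1 and Thm. 3]
[cite: Cesnavicius2018, Thm. 1.2] -/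
theorem not_dvd_maninConstant_of_isEdixhovenCesnaviciusTwistCoveredTwoEtaOne_gamma0
    (hM : mazur_not_dvd_maninConstant_of_odd)
    (hAU : abbesUllmo_not_dvd_maninConstant_of_not_dvd_level)
    (hC : cesnavicius_not_two_dvd_maninConstant_of_two_dvd_level)
    (hEA : edixhoven_not_dvd_maninConstant_of_not_potentiallyGoodOrdinary)
    (hEB : edixhoven_not_dvd_maninConstant_of_kodairaSymbol_ne)
    (hnf : exists_isNewformOf)
    {W : WeierstrassCurve ℚ} (hcov : IsEdixhovenCesnaviciusTwistCoveredTwoEtaOne W)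
    (W' : WeierstrassCurve ℚ) [W'.IsElliptic] [W'.IsGloballyMinimal] {N' : ℕ} [NeZero N']
    (D' : ModularParametrizationData W' N') (hiso : IsIsogenous W W')
    (hopt : ∀ z ∈ D'.L.lattice, ∃ w ∈ periodLattice D'.f, z = D'.c * w)
    (p : ℕ) (hp : p.Prime) : ¬ (p : ℤ) ∣ D'.maninConstant :=
  (classAbsManinConstantEqOne_of_isEdixhovenCesnaviciusTwistCoveredTwoEtaOne_gamma0 hM hAU hC hEA
    hEB hnf W hcov).not_dvd_maninConstant D' hiso hopt hp

end Literature.NumberTheory.EllipticCurves.ModularForms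

end
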